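import Summits.MatrixMultiplication.OmegaCensus.DicyclicLawZ4Z4OfDihClasses
import Summits.MatrixMultiplication.OmegaCensus.VertexCountingGap16
import Summits.MatrixMultiplication.OmegaCensus.DihedralLawModOneZ4Z4Five
import Summits.MatrixMultiplication.OmegaCensus.DicyclicLaw32Z4Z4Reduction
import HarnessLib

/-!
# The dicyclic law over `A/⟨c₀⟩ ↠ ℤ₄ × ℤ₄` for every `2`-group `A`, given the Dih side at `|A|/2`; the order `|A| = 512`

ω-census `pub-omega`, family (b3), seat pub-omega-group gen 16.  Framing: lottery ticket; floor = certified bounds/negative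
ranges.  VALUE: kernel theorems about the group-theoretic method (TPP capacity of dihedral-like groups); NOT progress on ω.

**Theorem (`no_dicyclic_law_of_onto_z4z4_of_dih`).** Let `G(A, c₀)` be of dicyclic type (`c₀ ≠ 0`) over a finite abelian
`2`-group `A` with `|A| = 2n`, let `Φ : A →+ ZMod 4 × ZMod 4` be onto with `Φ c₀ = 0`, and assume the Dih side at order `n`:
no dihedral-like group over an abelian `B` of order `n` mapping onto `ℤ₄²` has a TPP triple with `3|S'||T'||U'| + 8 = 8|B|`.
Then no TPP triple of `G` attains the dicyclic law `3|S||T||U| + 16 = 8|A|`.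

So the `ℤ₄²`-quotient column of the dicyclic classification is reduced, once and for all orders, to the `ℤ₄²`-quotient column
of the Dih classification at half the order (gen 14 / gen 15 proved the orders `128` / `32` as separate copies).

**Corollary (`no_dicyclic_law_card_512_of_onto_z4z4`).** `|A| = 512`, `A/⟨c₀⟩ ↠ ℤ₄²` ⇒ no dicyclic law — unconditionally, by
gen 15's `no_mod_one_law_card_256_of_onto_z4z4` (`(256−1)/3 = 85 = 5·17`, the part-`5` Gaussian-integer theorem).  With
`dicyclic_law_iff_of_quot` (attained iff `A/⟨c₀⟩ ∈ {ℤ₂₅₆, ℤ₂ × ℤ₁₂₈}` among quotients with a cyclic subgroup of index `≤ 2`),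
`no_dicyclic_law_of_onto_f2cube` (`2`-rank `≥ 3`) and this corollary (`A/⟨c₀⟩ ∈ {ℤ₄ × ℤ₆₄, ℤ₈ × ℤ₃₂, ℤ₁₆²}` and every
quotient containing `ℤ₄²`), the dicyclic law is now decided in the kernel for EVERY abelian `2`-group `A` of order `≤ 512`:
**attained ⟺ `A/⟨c₀⟩` has a cyclic subgroup of index `≤ 2`.**  Instances: the eight `(A, c₀)` of order `512` with
`A/⟨c₀⟩ ∈ {ℤ₄ × ℤ₆₄, ℤ₈ × ℤ₃₂, ℤ₁₆²}` up to automorphism.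

*Proof.*  Gen 15's slack-`16` shape lemma `two_balanced_of_vertex_bounds16` (two balanced members from `V ≥ 31`), then the
classes P1 / N1 / N2 / N3 / B exactly as in `DicyclicLaw128.lean`, with `no_dicyclic_law_of_two_domino_of_dih`,
`no_n1_dicyclic_law_z4z4`, `no_n2/n3/classB_dicyclic_law_of_dih`; the `2`-group `B` of the class theorems is `A/⟨c₀⟩`.
-/

namespace Summit.MatrixMultiplication.OmegaCensus

open Literature.Combinatorics.Additive Finset

/-! ## Assembly for every `2`-group -/

section Assembly

variable {A : Type} [AddCommGroup A] [DecidableEq A] [Fintype A] {G : Type} [Group G] [DecidableEq G]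
  {ρ τ : A → G} {c₀ : A} {B : Type} [AddCommGroup B] [DecidableEq B] [Fintype B]

/-- Two balanced members (`|S₀| = |S₁|`, `|T₀| = |T₁|`), `A/⟨c₀⟩ ↠ ℤ₄²` a `2`-group, Dih side at `|A|/2` given: no dicyclic
law (classes P1, B, N1, N2, N3 as in `no_dicyclic_law_of_two_balanced_128`). [folklore] -/
theorem no_dicyclic_law_of_two_balanced_of_dih
    (hρρ : ∀ a b, ρ a * ρ b = ρ (a + b)) (hρτ : ∀ a b, ρ a * τ b = τ (b - a))
    (hτρ : ∀ a b, τ a * ρ b = τ (a + b)) (hττ : ∀ a b, τ a * τ b = ρ (c₀ + b - a)) (hc₀ : c₀ ≠ 0)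
    (hρ : Function.Injective ρ) (hτ : Function.Injective τ) (hne : ∀ a b, ρ a ≠ τ b)
    (hsurj : ∀ g, (∃ a, ρ a = g) ∨ (∃ a, τ a = g)) {n : ℕ} (hA : Fintype.card A = 2 * n)
    (hDih : ∀ (B : Type) [AddCommGroup B] [DecidableEq B] [Fintype B] (H : Type) [Group H] [DecidableEq H]
      (ρ' τ' : B → H) (c' : B),
      (∀ a b, ρ' a * ρ' b = ρ' (a + b)) → (∀ a b, ρ' a * τ' b = τ' (b - a)) →
      (∀ a b, τ' a * ρ' b = τ' (a + b)) → (∀ a b, τ' a * τ' b = ρ' (c' + b - a)) →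
      Function.Injective ρ' → Function.Injective τ' → (∀ a b, ρ' a ≠ τ' b) →
      (∀ g, (∃ a, ρ' a = g) ∨ (∃ a, τ' a = g)) → Fintype.card B = n →
      ∀ φ : B →+ ZMod 4 × ZMod 4, Function.Surjective φ →
      ∀ S' T' U' : Finset H, TripleProductProperty S' T' U' →
        3 * (S'.card * T'.card * U'.card) + 8 ≠ 8 * Fintype.card B)
    (Φ : A →+ ZMod 4 × ZMod 4) (hΦ : Function.Surjective Φ) (hΦc : Φ c₀ = 0)
    (π : A →+ B) (hπ : Function.Surjective π) (hker : ∀ a : A, π a = 0 ↔ a = 0 ∨ a = c₀)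
    {m : ℕ} (hB : ∀ b : B, (2 ^ m) • b = 0)
    {S T U : Finset G} (h : TripleProductProperty S T U)
    (hs : (univ.filter fun a : A => ρ a ∈ S).card = (univ.filter fun a : A => τ a ∈ S).card)
    (ht : (univ.filter fun a : A => ρ a ∈ T).card = (univ.filter fun a : A => τ a ∈ T).card) :
    3 * (S.card * T.card * U.card) + 16 ≠ 8 * Fintype.card A := by
  intro hV
  have h16 : 16 ∣ Fintype.card A := sixteen_dvd_card_of_onto_z4z4 Φ hΦ
  obtain ⟨s, hs₀⟩ : ∃ s, (univ.filter fun a : A => ρ a ∈ S).card = s := ⟨_, rfl⟩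
  obtain ⟨t, ht₀⟩ : ∃ t, (univ.filter fun a : A => ρ a ∈ T).card = t := ⟨_, rfl⟩
  obtain ⟨u₀, hu₀⟩ : ∃ u, (univ.filter fun a : A => ρ a ∈ U).card = u := ⟨_, rfl⟩
  obtain ⟨u₁, hu₁⟩ : ∃ u, (univ.filter fun a : A => τ a ∈ U).card = u := ⟨_, rfl⟩
  have hs₁ : (univ.filter fun a : A => τ a ∈ S).card = s := by rw [← hs, hs₀]
  have ht₁ : (univ.filter fun a : A => τ a ∈ T).card = t := by rw [← ht, ht₀]
  have cS : S.card = s + s := by rw [card_eq_parts' hρ hτ hne hsurj S, hs₀, hs₁]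
  have cT : T.card = t + t := by rw [card_eq_parts' hρ hτ hne hsurj T, ht₀, ht₁]
  have cU : U.card = u₀ + u₁ := by rw [card_eq_parts' hρ hτ hne hsurj U, hu₀, hu₁]
  obtain ⟨h000, h111, -⟩ := vertex_counting' hρρ hρτ hτρ hττ hρ hτ hne h
  rw [hs₀, hs₁, ht₀, ht₁, hu₀, hu₁] at h000 h111
  have hV' := hV
  rw [cS, cT, cU] at hV'
  -- the unbalance `d` of `U` and the bound `s t d ≤ 4`
  obtain ⟨d, hd, hstd⟩ : ∃ d, (u₀ = u₁ + d ∨ u₁ = u₀ + d) ∧ s * t * d ≤ 4 := by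
    rcases le_total u₁ u₀ with hle | hle
    · obtain ⟨d, rfl⟩ := Nat.exists_eq_add_of_le hle
      refine ⟨d, Or.inl rfl, ?_⟩
      have e1 : s * t * (u₁ + d) = s * t * u₁ + s * t * d := by ring
      have e2 : (s + s) * (t + t) * (u₁ + d + u₁) = 8 * (s * t * u₁) + 4 * (s * t * d) := by ring
      rw [e1] at h000; rw [e2] at hV'; omega
    · obtain ⟨d, rfl⟩ := Nat.exists_eq_add_of_le hle
      refine ⟨d, Or.inr rfl, ?_⟩
      have e1 : s * t * (u₀ + d) = s * t * u₀ + s * t * d := by ring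
      have e2 : (s + s) * (t + t) * (u₀ + (u₀ + d)) = 8 * (s * t * u₀) + 4 * (s * t * d) := by ring
      rw [e1] at h111; rw [e2] at hV'; omega
  -- class B
  rcases Nat.eq_zero_or_pos d with rfl | hdpos
  · have hu : (univ.filter fun a : A => ρ a ∈ U).card = (univ.filter fun a : A => τ a ∈ U).card := by
      rw [hu₀, hu₁]; omega
    exact no_classB_dicyclic_law_of_dih hρρ hρτ hτρ hττ hc₀ hρ hτ hne hsurj hA hDih Φ hΦ hΦc π hker hB h hs ht hu
      hV
  have hU : (univ.filter fun a : A => ρ a ∈ U).card ≠ (univ.filter fun a : A => τ a ∈ U).card := by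
    rw [hu₀, hu₁]; omega
  have hst : s * t ≤ 4 := le_trans (Nat.le_mul_of_pos_right _ hdpos) hstd
  rcases Nat.eq_zero_or_pos s with rfl | hspos
  · simp at hV'; omega
  rcases Nat.eq_zero_or_pos t with rfl | htpos
  · simp at hV'; omega
  have hs4 : s ≤ 4 := le_trans (Nat.le_mul_of_pos_right _ htpos) hst
  have ht4 : t ≤ 4 := le_trans (Nat.le_mul_of_pos_left _ hspos) hst
  interval_cases s
  · -- `s = 1`
    obtain rfl | rfl | rfl | rfl : t = 1 ∨ t = 2 ∨ t = 3 ∨ t = 4 := by omega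
    · -- `(1,1)`: two dominoes
      exact no_dicyclic_law_of_two_domino_of_dih hρρ hρτ hτρ hττ hc₀ hρ hτ hne hsurj hA hDih Φ hΦ hΦc h hs₀ hs₁ ht₀
        ht₁ hV
    · -- `(1,2)`: class N1, roles `(S, T, U)`
      exact no_n1_dicyclic_law_z4z4 hρρ hρτ hτρ hττ hc₀ hρ hτ hne hsurj Φ hΦ hΦc π hπ hker hB h hs₀ hs₁ ht₀ ht₁ hU
        hV
    · -- `(1,3)`: `d = 1` contradicts the parity of `|U|`
      exfalso; omega
    · -- `(1,4)`: class N2, roles `(S, U, T)`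
      exact no_n2_dicyclic_law_of_dih hρρ hρτ hτρ hττ hc₀ hρ hτ hne hsurj hA hDih Φ hΦ hΦc π hker hB
        (tpp_reverse h).rotate.rotate hs₀ hs₁ ht₀ ht₁
        (by rw [show S.card * U.card * T.card = S.card * T.card * U.card by ring]; exact hV)
  · -- `s = 2`
    obtain rfl | rfl : t = 1 ∨ t = 2 := by omega
    · -- `(2,1)`: class N1, roles `(T, S, U)`
      exact no_n1_dicyclic_law_z4z4 hρρ hρτ hτρ hττ hc₀ hρ hτ hne hsurj Φ hΦ hΦc π hπ hker hB
        (tpp_reverse h).rotate ht₀ ht₁ hs₀ hs₁ hU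
        (by rw [show T.card * S.card * U.card = S.card * T.card * U.card by ring]; exact hV)
    · -- `(2,2)`: class N3
      exact no_n3_dicyclic_law_of_dih hρρ hρτ hτρ hττ hc₀ hρ hτ hne hsurj hA hDih Φ hΦ hΦc π hker hB h hs₀ hs₁ ht₀
        ht₁ hV
  · -- `s = 3`: `t = 1`, and `d = 1` contradicts the parity of `|U|`
    obtain rfl : t = 1 := by omega
    exfalso; omega
  · -- `s = 4`: `t = 1`, class N2, roles `(T, U, S)`
    obtain rfl : t = 1 := by omega
    exact no_n2_dicyclic_law_of_dih hρρ hρτ hτρ hττ hc₀ hρ hτ hne hsurj hA hDih Φ hΦ hΦc π hker hB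
      h.rotate ht₀ ht₁ hs₀ hs₁
      (by rw [show T.card * U.card * S.card = S.card * T.card * U.card by ring]; exact hV)

/-- **The dicyclic law over a `2`-group `A` with `A/⟨c₀⟩ ↠ ℤ₄ × ℤ₄ is not attained, given the Dih side at `|A|/2`.**
Dicyclic type `G(A, c₀)` (`c₀ ≠ 0`), `A` a `2`-group (`2ᵏ·A = 0`) with `|A| = 2n`, `hDih` = no dihedral-like group over an
abelian `B` of order `n` onto `ℤ₄²` attains `3V + 8 = 8|B|`, `Φ : A →+ ZMod 4 × ZMod 4` onto with `Φ c₀ = 0`.  For every TPP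
triple: `3|S||T||U| + 16 ≠ 8|A|`. [folklore] -/
theorem no_dicyclic_law_of_onto_z4z4_of_dih
    (hρρ : ∀ a b, ρ a * ρ b = ρ (a + b)) (hρτ : ∀ a b, ρ a * τ b = τ (b - a))
    (hτρ : ∀ a b, τ a * ρ b = τ (a + b)) (hττ : ∀ a b, τ a * τ b = ρ (c₀ + b - a)) (hc₀ : c₀ ≠ 0)
    (hρ : Function.Injective ρ) (hτ : Function.Injective τ) (hne : ∀ a b, ρ a ≠ τ b)
    (hsurj : ∀ g, (∃ a, ρ a = g) ∨ (∃ a, τ a = g)) {n : ℕ} (hA : Fintype.card A = 2 * n)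
    (hDih : ∀ (B : Type) [AddCommGroup B] [DecidableEq B] [Fintype B] (H : Type) [Group H] [DecidableEq H]
      (ρ' τ' : B → H) (c' : B),
      (∀ a b, ρ' a * ρ' b = ρ' (a + b)) → (∀ a b, ρ' a * τ' b = τ' (b - a)) →
      (∀ a b, τ' a * ρ' b = τ' (a + b)) → (∀ a b, τ' a * τ' b = ρ' (c' + b - a)) →
      Function.Injective ρ' → Function.Injective τ' → (∀ a b, ρ' a ≠ τ' b) →
      (∀ g, (∃ a, ρ' a = g) ∨ (∃ a, τ' a = g)) → Fintype.card B = n →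
      ∀ φ : B →+ ZMod 4 × ZMod 4, Function.Surjective φ →
      ∀ S' T' U' : Finset H, TripleProductProperty S' T' U' →
        3 * (S'.card * T'.card * U'.card) + 8 ≠ 8 * Fintype.card B)
    {k : ℕ} (hA2 : ∀ a : A, (2 ^ k) • a = 0)
    (Φ : A →+ ZMod 4 × ZMod 4) (hΦ : Function.Surjective Φ) (hΦc : Φ c₀ = 0)
    {S T U : Finset G} (h : TripleProductProperty S T U) :
    3 * (S.card * T.card * U.card) + 16 ≠ 8 * Fintype.card A := by
  classical
  intro hV
  have h16 : 16 ∣ Fintype.card A := sixteen_dvd_card_of_onto_z4z4 Φ hΦ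
  -- the `2`-group quotient `B = A/⟨c₀⟩`
  have h2c₀ : c₀ + c₀ = 0 := two_c0_eq_zero hρτ hτρ hττ hτ
  let K : AddSubgroup A := AddSubgroup.zmultiples c₀
  let π : A →+ A ⧸ K := QuotientAddGroup.mk' K
  have hker : ∀ x : A, π x = 0 ↔ x = 0 ∨ x = c₀ := by
    intro x
    rw [QuotientAddGroup.mk'_apply, QuotientAddGroup.eq_zero_iff]
    exact mem_zmultiples_of_two h2c₀ x
  have hπ : Function.Surjective π := QuotientAddGroup.mk'_surjective K
  have hB : ∀ b : A ⧸ K, (2 ^ k) • b = 0 := by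
    intro b
    obtain ⟨x, rfl⟩ := hπ b
    rw [← map_nsmul, hA2, map_zero]
  obtain ⟨h000, h111, h100, h011, h010, h101, h001, h110⟩ := vertex_counting' hρρ hρτ hτρ hττ hρ hτ hne h
  have hV' := hV
  rw [card_eq_parts' hρ hτ hne hsurj S, card_eq_parts' hρ hτ hne hsurj T, card_eq_parts' hρ hτ hne hsurj U] at hV'
  rcases two_balanced_of_vertex_bounds16 _ _ _ _ _ _ _ h000 h111 h100 h011 h010 h101 h001 h110 (by omega)
      (by omega) with ⟨hs, ht⟩ | ⟨hs, hu⟩ | ⟨ht, hu⟩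
  · exact no_dicyclic_law_of_two_balanced_of_dih hρρ hρτ hτρ hττ hc₀ hρ hτ hne hsurj hA hDih Φ hΦ hΦc π hπ hker hB
      h hs ht hV
  · have := no_dicyclic_law_of_two_balanced_of_dih hρρ hρτ hτρ hττ hc₀ hρ hτ hne hsurj hA hDih Φ hΦ hΦc π hπ
      hker hB h.rotate.rotate hu hs
    exact this (by rw [show U.card * S.card * T.card = S.card * T.card * U.card by ring]; exact hV)
  · have := no_dicyclic_law_of_two_balanced_of_dih hρρ hρτ hτρ hττ hc₀ hρ hτ hne hsurj hA hDih Φ hΦ hΦc π hπ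
      hker hB h.rotate ht hu
    exact this (by rw [show T.card * U.card * S.card = S.card * T.card * U.card by ring]; exact hV)

/-- **The dicyclic law at `|A| = 512` is not attained when `A/⟨c₀⟩ ↠ ℤ₄ × ℤ₄`** (unconditional: the Dih side at `256` is
gen 15's `no_mod_one_law_card_256_of_onto_z4z4`).  Dicyclic type `G(A, c₀)` (`c₀ ≠ 0`), `|A| = 512`,
`Φ : A →+ ZMod 4 × ZMod 4` onto with `Φ c₀ = 0`.  For every TPP triple: `3|S||T||U| + 16 ≠ 8|A|`. [folklore] -/
theorem no_dicyclic_law_card_512_of_onto_z4z4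
    (hρρ : ∀ a b, ρ a * ρ b = ρ (a + b)) (hρτ : ∀ a b, ρ a * τ b = τ (b - a))
    (hτρ : ∀ a b, τ a * ρ b = τ (a + b)) (hττ : ∀ a b, τ a * τ b = ρ (c₀ + b - a)) (hc₀ : c₀ ≠ 0)
    (hρ : Function.Injective ρ) (hτ : Function.Injective τ) (hne : ∀ a b, ρ a ≠ τ b)
    (hsurj : ∀ g, (∃ a, ρ a = g) ∨ (∃ a, τ a = g)) (hA : Fintype.card A = 512)
    (Φ : A →+ ZMod 4 × ZMod 4) (hΦ : Function.Surjective Φ) (hΦc : Φ c₀ = 0)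
    {S T U : Finset G} (h : TripleProductProperty S T U) :
    3 * (S.card * T.card * U.card) + 16 ≠ 8 * Fintype.card A :=
  no_dicyclic_law_of_onto_z4z4_of_dih hρρ hρτ hτρ hττ hc₀ hρ hτ hne hsurj (n := 256) (by rw [hA])
    (fun _ _ _ _ _ _ _ _ _ _ h₁ h₂ h₃ h₄ h₅ h₆ h₇ h₈ hB φ hφ _ _ _ hT =>
      no_mod_one_law_card_256_of_onto_z4z4 h₁ h₂ h₃ h₄ h₅ h₆ h₇ h₈ hB φ hφ hT)
    (k := 9) (fun a => by rw [show (2 ^ 9 : ℕ) = Fintype.card A by rw [hA]; norm_num, card_nsmul_eq_zero]) Φ hΦ hΦc h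

/-- The orders `128` and `32` again, now as instances of the general theorem (gen 14's
`no_dicyclic_law_card_128_of_onto_z4z4` and gen 15's `no_dicyclic_law_card_32_of_onto_z4z4` re-derived). [folklore] -/
theorem no_dicyclic_law_card_128_of_onto_z4z4'
    (hρρ : ∀ a b, ρ a * ρ b = ρ (a + b)) (hρτ : ∀ a b, ρ a * τ b = τ (b - a))
    (hτρ : ∀ a b, τ a * ρ b = τ (a + b)) (hττ : ∀ a b, τ a * τ b = ρ (c₀ + b - a)) (hc₀ : c₀ ≠ 0)
    (hρ : Function.Injective ρ) (hτ : Function.Injective τ) (hne : ∀ a b, ρ a ≠ τ b)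
    (hsurj : ∀ g, (∃ a, ρ a = g) ∨ (∃ a, τ a = g)) (hA : Fintype.card A = 128 ∨ Fintype.card A = 32)
    (Φ : A →+ ZMod 4 × ZMod 4) (hΦ : Function.Surjective Φ) (hΦc : Φ c₀ = 0)
    {S T U : Finset G} (h : TripleProductProperty S T U) :
    3 * (S.card * T.card * U.card) + 16 ≠ 8 * Fintype.card A := by
  rcases hA with hA | hA
  · exact no_dicyclic_law_of_onto_z4z4_of_dih hρρ hρτ hτρ hττ hc₀ hρ hτ hne hsurj (n := 64) (by rw [hA])
      (fun _ _ _ _ _ _ _ _ _ _ h₁ h₂ h₃ h₄ h₅ h₆ h₇ h₈ hB φ hφ _ _ _ hT =>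
        no_mod_one_law_card_64_of_onto_z4z4 h₁ h₂ h₃ h₄ h₅ h₆ h₇ h₈ hB φ hφ hT)
      (k := 7) (fun a => by rw [show (2 ^ 7 : ℕ) = Fintype.card A by rw [hA]; norm_num, card_nsmul_eq_zero]) Φ hΦ hΦc h
  · exact no_dicyclic_law_of_onto_z4z4_of_dih hρρ hρτ hτρ hττ hc₀ hρ hτ hne hsurj (n := 16) (by rw [hA])
      (fun _ _ _ _ _ _ _ _ _ _ h₁ h₂ h₃ h₄ h₅ h₆ h₇ h₈ hB φ hφ _ _ _ hT =>
        no_mod_one_law_card_16_of_onto_z4z4 h₁ h₂ h₃ h₄ h₅ h₆ h₇ h₈ hB φ hφ hT)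
      (k := 5) (fun a => by rw [show (2 ^ 5 : ℕ) = Fintype.card A by rw [hA]; norm_num, card_nsmul_eq_zero]) Φ hΦ hΦc h

end Assembly

/-! ## Instances at `|A| = 512` with `A/⟨c₀⟩ ∈ {ℤ₄ × ℤ₆₄, ℤ₈ × ℤ₃₂, ℤ₁₆²}` -/

section Instances

/-- The reduction `ℤ_m × ℤ_n ↠ ℤ₄ × ℤ₄` for `4 ∣ m`, `4 ∣ n`. [folklore] -/
theorem zm_zn_onto_z4z4 {m n : ℕ} (hm : 4 ∣ m) (hn : 4 ∣ n) : Function.Surjective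
    ((ZMod.castHom hm (ZMod 4)).toAddMonoidHom.prodMap (ZMod.castHom hn (ZMod 4)).toAddMonoidHom :
      ZMod m × ZMod n →+ ZMod 4 × ZMod 4) := by
  intro q
  obtain ⟨x, hx⟩ := ZMod.castHom_surjective hm (n := m) q.1
  obtain ⟨y, hy⟩ := ZMod.castHom_surjective hn (n := n) q.2
  exact ⟨(x, y), Prod.ext hx hy⟩

/-- The reduction `ℤ₂ × ℤ_m × ℤ_n ↠ ℤ₄ × ℤ₄` for `4 ∣ m`, `4 ∣ n` (forget the first factor). [folklore] -/
theorem z2_zm_zn_onto_z4z4 {m n : ℕ} (hm : 4 ∣ m) (hn : 4 ∣ n) : Function.Surjective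
    (((ZMod.castHom hm (ZMod 4)).toAddMonoidHom.prodMap (ZMod.castHom hn (ZMod 4)).toAddMonoidHom).comp
      (AddMonoidHom.snd (ZMod 2) (ZMod m × ZMod n)) : ZMod 2 × ZMod m × ZMod n →+ ZMod 4 × ZMod 4) := by
  intro q
  obtain ⟨x, hx⟩ := zm_zn_onto_z4z4 hm hn q
  exact ⟨(0, x), hx⟩

/-- **`G(ℤ₈ × ℤ₆₄, (4,0))` (`A/⟨c₀⟩ ≅ ℤ₄ × ℤ₆₄`, a group of order `1024`): the dicyclic law `3V + 16 = 8·512` is not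
attained.** [folklore] -/
theorem z8_z64_dicyclic_no_law_4_0 [Fact (((4, 0) : ZMod 8 × ZMod 64) + (4, 0) = 0)]
    (S T U : Finset (DihedralLikeGroup (ZMod 8 × ZMod 64) (4, 0)))
    (h : Literature.Combinatorics.Additive.TripleProductProperty S T U) :
    3 * (S.card * T.card * U.card) + 16 ≠ 8 * Fintype.card (ZMod 8 × ZMod 64) :=
  no_dicyclic_law_card_512_of_onto_z4z4 (A := ZMod 8 × ZMod 64) (c₀ := (4, 0))
    DihedralLikeGroup.rho_mul_rho DihedralLikeGroup.rho_mul_tau DihedralLikeGroup.tau_mul_rho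
    DihedralLikeGroup.tau_mul_tau (by decide) DihedralLikeGroup.rho_injective DihedralLikeGroup.tau_injective
    DihedralLikeGroup.rho_ne_tau DihedralLikeGroup.rho_or_tau (by simp)
    _ (zm_zn_onto_z4z4 (by norm_num) (by norm_num)) (by decide) h

/-- **`G(ℤ₈ × ℤ₆₄, (0,32))` (`A/⟨c₀⟩ ≅ ℤ₈ × ℤ₃₂`): the dicyclic law is not attained.** [folklore] -/
theorem z8_z64_dicyclic_no_law_0_32 [Fact (((0, 32) : ZMod 8 × ZMod 64) + (0, 32) = 0)]
    (S T U : Finset (DihedralLikeGroup (ZMod 8 × ZMod 64) (0, 32)))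
    (h : Literature.Combinatorics.Additive.TripleProductProperty S T U) :
    3 * (S.card * T.card * U.card) + 16 ≠ 8 * Fintype.card (ZMod 8 × ZMod 64) :=
  no_dicyclic_law_card_512_of_onto_z4z4 (A := ZMod 8 × ZMod 64) (c₀ := (0, 32))
    DihedralLikeGroup.rho_mul_rho DihedralLikeGroup.rho_mul_tau DihedralLikeGroup.tau_mul_rho
    DihedralLikeGroup.tau_mul_tau (by decide) DihedralLikeGroup.rho_injective DihedralLikeGroup.tau_injective
    DihedralLikeGroup.rho_ne_tau DihedralLikeGroup.rho_or_tau (by simp)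
    _ (zm_zn_onto_z4z4 (by norm_num) (by norm_num)) (by decide) h

/-- **`G(ℤ₄ × ℤ₁₂₈, (0,64))` (`A/⟨c₀⟩ ≅ ℤ₄ × ℤ₆₄`): the dicyclic law is not attained.** [folklore] -/
theorem z4_z128_dicyclic_no_law_0_64 [Fact (((0, 64) : ZMod 4 × ZMod 128) + (0, 64) = 0)]
    (S T U : Finset (DihedralLikeGroup (ZMod 4 × ZMod 128) (0, 64)))
    (h : Literature.Combinatorics.Additive.TripleProductProperty S T U) :
    3 * (S.card * T.card * U.card) + 16 ≠ 8 * Fintype.card (ZMod 4 × ZMod 128) :=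
  no_dicyclic_law_card_512_of_onto_z4z4 (A := ZMod 4 × ZMod 128) (c₀ := (0, 64))
    DihedralLikeGroup.rho_mul_rho DihedralLikeGroup.rho_mul_tau DihedralLikeGroup.tau_mul_rho
    DihedralLikeGroup.tau_mul_tau (by decide) DihedralLikeGroup.rho_injective DihedralLikeGroup.tau_injective
    DihedralLikeGroup.rho_ne_tau DihedralLikeGroup.rho_or_tau (by simp)
    _ (zm_zn_onto_z4z4 (by norm_num) (by norm_num)) (by decide) h

/-- **`G(ℤ₁₆ × ℤ₃₂, (8,0))` (`A/⟨c₀⟩ ≅ ℤ₈ × ℤ₃₂`): the dicyclic law is not attained.** [folklore] -/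
theorem z16_z32_dicyclic_no_law_8_0 [Fact (((8, 0) : ZMod 16 × ZMod 32) + (8, 0) = 0)]
    (S T U : Finset (DihedralLikeGroup (ZMod 16 × ZMod 32) (8, 0)))
    (h : Literature.Combinatorics.Additive.TripleProductProperty S T U) :
    3 * (S.card * T.card * U.card) + 16 ≠ 8 * Fintype.card (ZMod 16 × ZMod 32) :=
  no_dicyclic_law_card_512_of_onto_z4z4 (A := ZMod 16 × ZMod 32) (c₀ := (8, 0))
    DihedralLikeGroup.rho_mul_rho DihedralLikeGroup.rho_mul_tau DihedralLikeGroup.tau_mul_rho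
    DihedralLikeGroup.tau_mul_tau (by decide) DihedralLikeGroup.rho_injective DihedralLikeGroup.tau_injective
    DihedralLikeGroup.rho_ne_tau DihedralLikeGroup.rho_or_tau (by simp)
    _ (zm_zn_onto_z4z4 (by norm_num) (by norm_num)) (by decide) h

/-- **`G(ℤ₁₆ × ℤ₃₂, (0,16))` (`A/⟨c₀⟩ ≅ ℤ₁₆ × ℤ₁₆`): the dicyclic law is not attained.** [folklore] -/
theorem z16_z32_dicyclic_no_law_0_16 [Fact (((0, 16) : ZMod 16 × ZMod 32) + (0, 16) = 0)]
    (S T U : Finset (DihedralLikeGroup (ZMod 16 × ZMod 32) (0, 16)))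
    (h : Literature.Combinatorics.Additive.TripleProductProperty S T U) :
    3 * (S.card * T.card * U.card) + 16 ≠ 8 * Fintype.card (ZMod 16 × ZMod 32) :=
  no_dicyclic_law_card_512_of_onto_z4z4 (A := ZMod 16 × ZMod 32) (c₀ := (0, 16))
    DihedralLikeGroup.rho_mul_rho DihedralLikeGroup.rho_mul_tau DihedralLikeGroup.tau_mul_rho
    DihedralLikeGroup.tau_mul_tau (by decide) DihedralLikeGroup.rho_injective DihedralLikeGroup.tau_injective
    DihedralLikeGroup.rho_ne_tau DihedralLikeGroup.rho_or_tau (by simp)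
    _ (zm_zn_onto_z4z4 (by norm_num) (by norm_num)) (by decide) h

/-- **`G(ℤ₂ × ℤ₄ × ℤ₆₄, (1,0,0))` (`A/⟨c₀⟩ ≅ ℤ₄ × ℤ₆₄`, split): the dicyclic law is not attained.** [folklore] -/
theorem z2_z4_z64_dicyclic_no_law [Fact (((1, 0, 0) : ZMod 2 × ZMod 4 × ZMod 64) + (1, 0, 0) = 0)]
    (S T U : Finset (DihedralLikeGroup (ZMod 2 × ZMod 4 × ZMod 64) (1, 0, 0)))
    (h : Literature.Combinatorics.Additive.TripleProductProperty S T U) :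
    3 * (S.card * T.card * U.card) + 16 ≠ 8 * Fintype.card (ZMod 2 × ZMod 4 × ZMod 64) :=
  no_dicyclic_law_card_512_of_onto_z4z4 (A := ZMod 2 × ZMod 4 × ZMod 64) (c₀ := (1, 0, 0))
    DihedralLikeGroup.rho_mul_rho DihedralLikeGroup.rho_mul_tau DihedralLikeGroup.tau_mul_rho
    DihedralLikeGroup.tau_mul_tau (by decide) DihedralLikeGroup.rho_injective DihedralLikeGroup.tau_injective
    DihedralLikeGroup.rho_ne_tau DihedralLikeGroup.rho_or_tau (by simp)
    _ (z2_zm_zn_onto_z4z4 (by norm_num) (by norm_num)) (by decide) h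

/-- **`G(ℤ₂ × ℤ₈ × ℤ₃₂, (1,0,0))` (`A/⟨c₀⟩ ≅ ℤ₈ × ℤ₃₂`, split): the dicyclic law is not attained.** [folklore] -/
theorem z2_z8_z32_dicyclic_no_law [Fact (((1, 0, 0) : ZMod 2 × ZMod 8 × ZMod 32) + (1, 0, 0) = 0)]
    (S T U : Finset (DihedralLikeGroup (ZMod 2 × ZMod 8 × ZMod 32) (1, 0, 0)))
    (h : Literature.Combinatorics.Additive.TripleProductProperty S T U) :
    3 * (S.card * T.card * U.card) + 16 ≠ 8 * Fintype.card (ZMod 2 × ZMod 8 × ZMod 32) :=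
  no_dicyclic_law_card_512_of_onto_z4z4 (A := ZMod 2 × ZMod 8 × ZMod 32) (c₀ := (1, 0, 0))
    DihedralLikeGroup.rho_mul_rho DihedralLikeGroup.rho_mul_tau DihedralLikeGroup.tau_mul_rho
    DihedralLikeGroup.tau_mul_tau (by decide) DihedralLikeGroup.rho_injective DihedralLikeGroup.tau_injective
    DihedralLikeGroup.rho_ne_tau DihedralLikeGroup.rho_or_tau (by simp)
    _ (z2_zm_zn_onto_z4z4 (by norm_num) (by norm_num)) (by decide) h

/-- **`G(ℤ₂ × ℤ₁₆ × ℤ₁₆, (1,0,0))` (`A/⟨c₀⟩ ≅ ℤ₁₆²`, split): the dicyclic law is not attained.** [folklore] -/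
theorem z2_z16_z16_dicyclic_no_law [Fact (((1, 0, 0) : ZMod 2 × ZMod 16 × ZMod 16) + (1, 0, 0) = 0)]
    (S T U : Finset (DihedralLikeGroup (ZMod 2 × ZMod 16 × ZMod 16) (1, 0, 0)))
    (h : Literature.Combinatorics.Additive.TripleProductProperty S T U) :
    3 * (S.card * T.card * U.card) + 16 ≠ 8 * Fintype.card (ZMod 2 × ZMod 16 × ZMod 16) :=
  no_dicyclic_law_card_512_of_onto_z4z4 (A := ZMod 2 × ZMod 16 × ZMod 16) (c₀ := (1, 0, 0))
    DihedralLikeGroup.rho_mul_rho DihedralLikeGroup.rho_mul_tau DihedralLikeGroup.tau_mul_rho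
    DihedralLikeGroup.tau_mul_tau (by decide) DihedralLikeGroup.rho_injective DihedralLikeGroup.tau_injective
    DihedralLikeGroup.rho_ne_tau DihedralLikeGroup.rho_or_tau (by simp)
    _ (z2_zm_zn_onto_z4z4 (by norm_num) (by norm_num)) (by decide) h

end Instances

end Summit.MatrixMultiplication.OmegaCensus
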